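import Summits.BirchSwinnertonDyer.BirchSwinnertonDyer.Theorems.ResidualThetaTransportAtTwoKatoZetaDefs
import Summits.BirchSwinnertonDyer.BirchSwinnertonDyer.Theorems.ThetaPartnerAtTwoSignedKatoUpToAtTwoKatoBKCoreKZLit
import Summits.BirchSwinnertonDyer.BirchSwinnertonDyer.Theorems.ThetaPartnerAtTwoSignedKatoUpToAtTwoCyclotomicPadicEmbedding
import Summits.BirchSwinnertonDyer.BirchSwinnertonDyer.Theorems.ResidualThetaTransportAtTwoResidualSignedLambdaLowerCMAtTwoChildACoordinates
import Literature.NumberTheory.EllipticCurves.Kato2004.ZetaElementNewformTatePairingValuesTwo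
import HarnessLib

/-!
# Child A of KZ_g at the one-pair pins (crux RSL_g `ResidualSignedLambdaLowerCMAtTwo`, stmt-BirchSwinnertonDyer-22608, line `onepair`) —
# file A3: the POINTWISE core of the port (stub-critic Q174): the valued class AT A GIVEN CLASS `z`

Route `ResidualThetaTransportAtTwo` (RTT); width seat `bsd-wall-tp2-p2x-w3` g20 (`--supports stmt-BirchSwinnertonDyer-22608`, helper; closes no item).
THEOREMS ONLY (no definition, no named fact, no instance, no notation, no `sorry`). BSD is not proved by anything here; 22608 / 26074 stay OPEN,
24105 HELD.

WHY. File A2 (`…StubKzgChildA`, p728621) ports Kato Thm. 12.5 (1) BY NAME (`Kato2004.exists_zetaElement_newform_tatePairing_values_two`, p726418)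
to `∃ z c′ w q μt, π.KatoValuedClass g ι Ω F.Φ F.τ z c′ w q μt` in ONE theorem that destructures the fact and builds the witnesses. The successor
print text «Kato125AB» (stub-ideation k2-g31 `KatoValuesQuotientTwoText`, STUB-PLAN rev 33.1 row 113, typer lane «Kato125b») keeps p726418's
telescope and conclusion VERBATIM and APPENDS the child-B clauses (FIN)/(FINX)/(LAM) about THE SAME class `z`. Its port (ROAD M: one merged stub
`stub_kzgChildAB : ∃ z c′ w q μt, KatoValuedClass … ∧ (ii_fin)(z) ∧ (ii_λ)(z, μt)`, or ROAD S) must therefore produce the valued class for the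
class `z` the fact names — not for some class. This file cuts that POINTWISE statement out of A2:

* **`katoValuedClass_of_zetaData`** — for a pin bundle `π`, a frame `F`, an embedding tower `e_k : ℚ(ζ_{2^k}) → ℚ̄₂` with `e_k(ζ_{2^k}) = zeta 2 k`,
  and DATA `(z, ℓ, L, f, u, r)` satisfying p726418's five conclusion clauses `r ≠ 0`, (ND), (BK), (VAL), (TRIV) VERBATIM (instantiated at the pins,
  at `Θ π.v π.hv`, `π.pair`, `F.Φ`, `F.τ`, `ζc_k := zeta_k`, `e`): `∃ c′ w q, π.KatoValuedClass g ι Ω F.Φ F.τ z c′ w q 1` — the SAME `z`, `μt = 1`.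
  Proof = A2's witnesses and clause-by-clause derivation (P1, P2, P4, P5), unchanged.
* **`exists_katoValuedClass_one_of_zetaElement`** — the litmus test that the core's hypotheses are LITERALLY p726418's conclusion at the pins: the
  fact ⟹ `∃ z c′ w q, π.KatoValuedClass g ι Ω F.Φ F.τ z c′ w q 1` by `obtain` + `exact katoValuedClass_of_zetaData …` (frame from
  A2's `ChildA.exists_cyclotomicFrame`, inlined, P3). This file does NOT import A2 (which sits in the Theses cone): A2's three small frame lemmas are inlined as `have`s where used, so the file and the ports built on it are route-independent.

With the child-B kit (`…ChildBKitSelmer`, `…ChildBKit`: H-STAB / H-SEL / H-ISO, the `X`-binder, `childB_clauses_of_fin_lam`) the merged port reads: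
frame (P3); `obtain ⟨z, ℓ, L, f, u, r, hr, hND, hBK, hVAL, hTRIV, hFIN, hFINX, hLAM⟩ := «Kato125AB» … X hXO hX …`;
`obtain ⟨c′, w, q, hK⟩ := katoValuedClass_of_zetaData …`; `exact ⟨z, c′, w, q, 1, hK, childB_clauses_of_fin_lam … hFIN hLAM⟩`.

References: [Kato2004Asterisque] Thm. 12.5 (1) (pp. 221–222), §15.16 (p. 265); [BlochKato1990] §3 (3.10.1), (3.11); [Kobayashi2003] (8.23), (8.29);
[Lang2002] Ch. VI §5 Cor. 5.3. Tree: `…StubKzgChildA.lean` (A2, p728621), `…ChildACoordinates.lean` (A1, p727504), `…KatoZetaDefs.lean`.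
-/

set_option autoImplicit false
-- the Theorems namespace of this sub repeats the summit name by design (D-0017 nested layout)
set_option linter.dupNamespace false
-- `IsCyclotomicExtension {2^k} ℚ (CyclotomicField (2^k) ℚ)` through `NeZero`, as in `KatoZetaDefs` / `CyclotomicPadicEmbedding` / A2
set_option backward.isDefEq.respectTransparency false

noncomputable section

open scoped Classical NumberField TensorProduct

namespace Summit.BirchSwinnertonDyer.BirchSwinnertonDyer.Theorems.OnePair

open Literature.NumberTheory.EllipticCurves Literature.NumberTheory.EllipticCurves.GreenbergSelmer
open Literature.NumberTheory.GaloisRepresentations NumberField IsDedekindDomain Field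
open GreenbergVatsal2000 Kobayashi2003 Rat.HeightOneSpectrum PowerSeries
open Literature.NumberTheory.EllipticCurves.FormalGroupChart
open Literature.NumberTheory.EllipticCurves.ModularForms
open Literature.NumberTheory.EllipticCurves.Kato2004 Literature.NumberTheory.EllipticCurves.Kato2004.EulerSystemValues
open Summit.BirchSwinnertonDyer.Rank1Residual.Additive Summit.BirchSwinnertonDyer.Rank1Residual.Additive.PadicCyclotomicTower
  Summit.BirchSwinnertonDyer.Rank1Residual.Additive.BallEval
open Summit.BirchSwinnertonDyer.BirchSwinnertonDyer.Theorems.SignedKatoOffTwo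
  Summit.BirchSwinnertonDyer.BirchSwinnertonDyer.Theorems.SignedKatoOffTwo.LocalTwo

section Core

variable {M : ℕ} [NeZero M] (g : CuspForm (CongruenceSubgroup.Gamma0 M) 2) (ι : coeffField g →+* PadicAlgCl 2) (Ω : ℂ)
  {W : WeierstrassCurve ℚ} [W.IsElliptic] [W.IsGloballyMinimal] {κ : ZpExtension ℚ 2} {γ : absoluteGaloisGroup ℚ}
  {S₀ : Finset (HeightOneSpectrum (𝓞 ℚ))} {n : ℕ} {ρ : FramedGaloisRep ℚ ↥(padicCoeffIntegers (Set.range ι)) 2}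
  {Θ : ∀ v : HeightOneSpectrum (𝓞 ℚ), ((2 : ℕ) : 𝓞 ℚ) ∈ v.asIdeal →
    (Cofree ρ ↥(padicCoeffField (Set.range ι)) ≃+ (Fin n → ↥(W.geomPrimaryTorsion 2)))}
  {hΘ : ∀ v hv (δ : absoluteGaloisGroup (v.adicCompletion ℚ)) m i,
    Θ v hv (resGalOfEmb (closureEmb (K := ℚ) (v.adicCompletion ℚ)) δ • m) i = resGalOfEmb (closureEmb (K := ℚ) (v.adicCompletion ℚ)) δ • Θ v hv m i}
  {I : Kato2004.IwasawaH1DataCoeff (FramedGaloisRep.toGaloisRep ρ) 2 κ γ}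
  {Sg : AddSubgroup (subgroupH1 κ.kerSubgroup (Cofree ρ ↥(padicCoeffField (Set.range ι))))}
  [Module ↥(padicCoeffIntegers (Set.range ι)) ↥Sg]
  (π : OnePairPins (Set.range ι) W κ γ S₀ n ρ Θ hΘ I Sg) (F : π.KatoFrame)

set_option maxHeartbeats 1600000 in
/-- **THE POINTWISE CORE OF THE PORT (Q174).** For `g ∈ S₂(Γ₀(M))` with `M` odd and `a₂(g) = 0`, `ι : K_g → ℚ̄₂`, `Ω`, a pin bundle `π`, a frame
`F`, an embedding tower `e_k : ℚ(ζ_{2^k}) →ₐ[ℚ] ℚ̄₂` with `e_k(ζ_{2^k}) = zeta 2 k`, and DATA `(z, ℓ, L, f, u, r)` — a class `z ∈ 𝐇¹_Γ(T_ρ)`,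
comparison functionals `ℓ_i`, rational values `Σ_k f_{N,k} ⊗ u_{N,k}`, a period ratio `r` — satisfying the five conclusion clauses of
`Kato2004.exists_zetaElement_newform_tatePairing_values_two` VERBATIM at the pins (`r ≠ 0`, (ND), (BK) against `π.pair` through `F.Φ`/`F.τ`/`e`,
(VAL), (TRIV)): the valued class holds AT THIS `z` with `μt = 1`, `∃ c′ w q, π.KatoValuedClass g ι Ω F.Φ F.τ z c′ w q 1`. Witnesses as in A2:
`c′_i = Σ_j 2^s ℓ_i(bO_j) bO′_j`, `w_{N,j} = Σ_k 2^{−(t_N+s)} t₀(2^{t_N} ι f_{N,k} · bO′_j) e_N(u_{N,k})`, `q = 2^{−s} ι(r)`.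
[cite: Kato2004Asterisque, Thm. 12.5 (1) (pp. 221–222), §15.16 (p. 265)] [cite: BlochKato1990, §3 (3.10.1), (3.11) (pp. 359–361)]
[cite: Kobayashi2003, (8.23) (p. 18), (8.29) (p. 24)] [cite: Lang2002, Ch. VI §5 Cor. 5.3] -/
theorem katoValuedClass_of_zetaData (hM : Odd M) (ha2 : cuspCoeff g 2 = 0)
    (e : ∀ k : ℕ, CyclotomicField (2 ^ k) ℚ →ₐ[ℚ] PadicAlgCl 2)
    (he : ∀ k, e k (IsCyclotomicExtension.zeta (2 ^ k) ℚ (CyclotomicField (2 ^ k) ℚ)) = zeta 2 k)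
    (z : I.H) (ℓ : Fin n → (PadicAlgCl 2 →ₗ[ℚ_[2]] ℚ_[2])) (L : ℕ → ℕ)
    (f : ∀ N : ℕ, Fin (L N) → coeffField g) (u : ∀ N : ℕ, Fin (L N) → CyclotomicField (2 ^ N) ℚ) (r : coeffField g)
    (hr : r ≠ 0)
    (hND : Function.Injective (fun (a : ↥(padicCoeffIntegers (Set.range ι))) (i : Fin n) => ℓ i (a : PadicAlgCl 2)))
    (hBK : ∀ (a : ↥(padicCoeffIntegers (Set.range ι))) (m : ℕ) (i : Fin n) (Q₀ : localPoints W ℚ_[2])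
      (hQv : WeierstrassCurve.Affine.Point.map (W' := W)
          (F.Φ : AlgebraicClosure ℚ_[2] →ₐ[ℚ] AlgebraicClosure (π.v.adicCompletion ℚ))
          (show (W.baseChange (AlgebraicClosure ℚ_[2])).toAffine.Point from Q₀) ∈
        localLayerPointsOfEmb κ (closureEmb (K := ℚ) (π.v.adicCompletion ℚ)) W m),
      (∀ (X Y : AlgebraicClosure ℚ_[2]) (hXY : (W.baseChange (AlgebraicClosure ℚ_[2])).toAffine.Nonsingular X Y),
          (show (W.baseChange (AlgebraicClosure ℚ_[2])).toAffine.Point from Q₀) = .some X Y hXY → 1 < Valued.v X) →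
      algebraMap ℚ_[2] (PadicAlgCl 2)
          ((π.pair m (I.proj m ((PowerSeries.C (a : ↥(padicCoeffIntegers (Set.range ι))) :
              IwasawaAlgebraO (Set.range ι)) • z)) (Pi.single i ⟨_, hQv⟩) : ℤ_[2]) : ℚ_[2]) =
        ∑ k : Fin (L (m + 2)), algebraMap ℚ_[2] (PadicAlgCl 2) (ℓ i ((a : PadicAlgCl 2) * ι (f (m + 2) k))) *
          ∑ b : (ZMod (2 ^ (m + 2)))ˣ, F.τ (m + 2) (b : ZMod (2 ^ (m + 2))) •
            ((∑' j : ℕ, algebraMap ℚ_[2] (PadicAlgCl 2) (PowerSeries.coeff j (W.map (algebraMap ℚ ℚ_[2])).formalLog) *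
                (WeierstrassCurve.Affine.Point.zCoord
                  (show (W.baseChange (AlgebraicClosure ℚ_[2])).toAffine.Point from Q₀)) ^ j) *
              e (m + 2) (u (m + 2) k)))
    (hVAL : ∀ (N : ℕ), 2 ≤ N → ∀ (R : Type) [Field R] (s₁ : coeffField g →+* R) (s₂ : CyclotomicField (2 ^ N) ℚ →+* R)
      (χ : DirichletCharacter R (2 ^ N)), χ (-1) = 1 → χ.IsPrimitive →
      (∑ k : Fin (L N), s₁ (f N k) *
          ∑ b : (ZMod (2 ^ N))ˣ, χ⁻¹ (b : ZMod (2 ^ N)) * s₂ (sigma (2 ^ N) b (u N k))) *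
        gaussSum χ (AddChar.zmodChar (2 ^ N)
          (((IsCyclotomicExtension.zeta_spec (2 ^ N) ℚ (CyclotomicField (2 ^ N) ℚ)).map_of_injective s₂.injective).pow_eq_one)) =
      s₁ r * ∑ a : ZMod (2 ^ N), χ a * s₁ (plusSymbolK g Ω ((a.val : ℚ) / (2 : ℚ) ^ N)))
    (hTRIV : ∀ (N : ℕ), 2 ≤ N → ∀ (R : Type) [Field R] (s₁ : coeffField g →+* R) (s₂ : CyclotomicField (2 ^ N) ℚ →+* R),
      2 * ∑ k : Fin (L N), s₁ (f N k) * ∑ b : (ZMod (2 ^ N))ˣ, s₂ (sigma (2 ^ N) b (u N k)) =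
        s₁ r * (2 - s₁ ⟨cuspCoeff g 2, coeff_mem_coeffField g 2⟩ + (if 2 ∣ M then 0 else 1)) * s₁ (plusSymbolK g Ω 0)) :
    ∃ (c' : Fin n → ↥(padicCoeffIntegers (Set.range ι))) (w : ℕ → Fin π.nb → PadicAlgCl 2) (q : PadicAlgCl 2),
      π.KatoValuedClass g ι Ω F.Φ F.τ z c' w q 1 := by
  have h2 : (2 : ℚ_[2]) ≠ 0 := two_ne_zero
  -- (P2) Frobenius coordinates of the comparison functionals: `t₀(c′_i a) = 2^s ℓ_i(a)` on `𝒪`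
  obtain ⟨s, c', hc'⟩ := ThetaTransport.ChildA.exists_frobeniusCoords π.t₀ π.ht₀ π.bO π.bO' π.hbO ℓ
  have hc'' : ∀ (i : Fin n) (a : ↥(padicCoeffIntegers (Set.range ι))),
      ((π.t₀ (c' i * a) : ℤ_[2]) : ℚ_[2]) = (2 : ℚ_[2]) ^ s * ℓ i (a : PadicAlgCl 2) := by
    intro i a; rw [hc' i a, Nat.cast_ofNat]
  -- (P2) integrality exponents of the rational values: `2^{t_N} ι f_{N,k} = φ_{N,k} ∈ 𝒪`
  have hmem : ∀ (N : ℕ) (k : Fin (L N)), ι (f N k) ∈ padicCoeffField (Set.range ι) := fun N k ↦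
    IntermediateField.subset_adjoin ℚ_[2] (Set.range ι) ⟨f N k, rfl⟩
  have hφex : ∀ N : ℕ, ∃ (t : ℕ) (φ : Fin (L N) → ↥(padicCoeffIntegers (Set.range ι))),
      ∀ k, (φ k : PadicAlgCl 2) = algebraMap ℚ_[2] (PadicAlgCl 2) ((2 : ℚ_[2]) ^ t) * ι (f N k) := by
    intro N
    obtain ⟨t, ht⟩ := ThetaTransport.ChildA.exists_pow_forall_mul_mem_padicCoeffIntegers (Set.range ι)
      (fun k : Fin (L N) ↦ (⟨ι (f N k), hmem N k⟩ : padicCoeffField (Set.range ι)))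
    refine ⟨t, fun k ↦ ⟨_, ht k⟩, fun k ↦ ?_⟩
    simp only [Nat.cast_ofNat]
  choose t φ hφ using hφex
  -- the witnesses: `d_{N,j,k} = 2^{-(t_N+s)} t₀(φ_{N,k} bO′_j)`, `w_{N,j} = Σ_k d_{N,j,k} e_N(u_{N,k})`, `q = 2^{-s} ι(r)`, `μt = 1`
  obtain ⟨d, hd⟩ : ∃ d : ∀ N : ℕ, Fin π.nb → Fin (L N) → ℚ_[2],
      ∀ N j k, d N j k = ((2 : ℚ_[2]) ^ (t N + s))⁻¹ * ((π.t₀ (φ N k * π.bO' j) : ℤ_[2]) : ℚ_[2]) :=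
    ⟨_, fun _ _ _ ↦ rfl⟩
  obtain ⟨w, hw⟩ : ∃ w : ℕ → Fin π.nb → PadicAlgCl 2,
      ∀ N j, w N j = ∑ k : Fin (L N), algebraMap ℚ_[2] (PadicAlgCl 2) (d N j k) * e N (u N k) :=
    ⟨_, fun _ _ ↦ rfl⟩
  obtain ⟨q, hq⟩ : ∃ q : PadicAlgCl 2, q = algebraMap ℚ_[2] (PadicAlgCl 2) (((2 : ℚ_[2]) ^ s)⁻¹) * ι r := ⟨_, rfl⟩
  -- KEY: recombination along `bO` undoes the coordinates: `Σ_j bO_j Σ_k d_{N,j,k} A_k = 2^{-s} Σ_k ι(f_{N,k}) A_k`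
  have key : ∀ (N : ℕ) (Av : Fin (L N) → PadicAlgCl 2),
      ∑ j, (π.bO j : PadicAlgCl 2) * ∑ k, algebraMap ℚ_[2] (PadicAlgCl 2) (d N j k) * Av k =
        algebraMap ℚ_[2] (PadicAlgCl 2) (((2 : ℚ_[2]) ^ s)⁻¹) * ∑ k, ι (f N k) * Av k := by
    intro N Av
    have hswap : ∑ j, (π.bO j : PadicAlgCl 2) * ∑ k, algebraMap ℚ_[2] (PadicAlgCl 2) (d N j k) * Av k =
        ∑ k, (∑ j, algebraMap ℚ_[2] (PadicAlgCl 2) (d N j k) * (π.bO j : PadicAlgCl 2)) * Av k := by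
      simp only [Finset.mul_sum, Finset.sum_mul]
      rw [Finset.sum_comm]
      refine Finset.sum_congr rfl fun k _ ↦ Finset.sum_congr rfl fun j _ ↦ ?_
      ring
    rw [hswap, Finset.mul_sum]
    refine Finset.sum_congr rfl fun k _ ↦ ?_
    have h1 : ∑ j, algebraMap ℚ_[2] (PadicAlgCl 2) (d N j k) * (π.bO j : PadicAlgCl 2) =
        algebraMap ℚ_[2] (PadicAlgCl 2) (((2 : ℚ_[2]) ^ (t N + s))⁻¹) * (φ N k : PadicAlgCl 2) := by
      rw [ThetaTransport.ChildA.coe_eq_sum_t₀_mul_bO π.t₀ π.bO π.bO' π.hbO (φ N k), Finset.mul_sum]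
      refine Finset.sum_congr rfl fun j _ ↦ ?_
      rw [hd, map_mul, mul_assoc]
    have h2pow : ((2 : ℚ_[2]) ^ (t N + s))⁻¹ * (2 : ℚ_[2]) ^ t N = ((2 : ℚ_[2]) ^ s)⁻¹ := by
      rw [pow_add, mul_inv, mul_assoc, mul_comm ((2 : ℚ_[2]) ^ s)⁻¹, ← mul_assoc, inv_mul_cancel₀ (pow_ne_zero _ h2),
        one_mul]
    rw [h1, hφ N k, ← mul_assoc, ← map_mul, h2pow, mul_assoc]
  -- KEY-BK: `ℓ_i(a ι f_{N,k}) = Σ_j t₀(c′_i a bO_j) d_{N,j,k}`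
  have keyBK : ∀ (N : ℕ) (a : ↥(padicCoeffIntegers (Set.range ι))) (i : Fin n) (k : Fin (L N)),
      ℓ i ((a : PadicAlgCl 2) * ι (f N k)) = ∑ j, ((π.t₀ (c' i * a * π.bO j) : ℤ_[2]) : ℚ_[2]) * d N j k := by
    intro N a i k
    have hf : ι (f N k) = algebraMap ℚ_[2] (PadicAlgCl 2) (((2 : ℚ_[2]) ^ t N)⁻¹) * (φ N k : PadicAlgCl 2) := by
      rw [hφ N k, ← mul_assoc, ← map_mul, inv_mul_cancel₀ (pow_ne_zero _ h2), map_one, one_mul]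
    have h3 : (a : PadicAlgCl 2) * ι (f N k) =
        algebraMap ℚ_[2] (PadicAlgCl 2) (((2 : ℚ_[2]) ^ t N)⁻¹) * ((a * φ N k : ↥(padicCoeffIntegers (Set.range ι))) : PadicAlgCl 2) := by
      rw [hf]; push_cast; ring
    rw [h3, ← Algebra.smul_def, map_smul, smul_eq_mul]
    have h4 : ℓ i ((a * φ N k : ↥(padicCoeffIntegers (Set.range ι))) : PadicAlgCl 2) =
        ((2 : ℚ_[2]) ^ s)⁻¹ * ((π.t₀ (c' i * (a * φ N k)) : ℤ_[2]) : ℚ_[2]) := by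
      rw [hc'' i (a * φ N k), ← mul_assoc, inv_mul_cancel₀ (pow_ne_zero _ h2), one_mul]
    rw [h4, ← mul_assoc (c' i) a (φ N k), ThetaTransport.ChildA.coe_t₀_mul_eq_sum π.t₀ π.ht₀ π.bO π.bO' π.hbO (c' i * a) (φ N k),
      Finset.mul_sum, Finset.mul_sum]
    refine Finset.sum_congr rfl fun j _ ↦ ?_
    rw [hd, pow_add, mul_inv]
    ring
  -- the frame relation `τ_b • e_N(y) = e_N(σ_b y)` (A2's `ChildA.smul_frame_eq_map_sigma`, inlined to stay outside the Theses cone)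
  have hframe : ∀ (N : ℕ) (b : (ZMod (2 ^ N))ˣ) (y : CyclotomicField (2 ^ N) ℚ),
      F.τ N (b : ZMod (2 ^ N)) • e N y = e N (sigma (2 ^ N) b y) := fun N b y ↦
    (KatoValue.map_sigma_eq_smul (p := 2) (k := N) (m := 2 ^ N) (e N : CyclotomicField (2 ^ N) ℚ →+* PadicAlgCl 2)
      (he N) (F.τ N (b : ZMod (2 ^ N))) b (F.hτ N _ b.isUnit) y).symm
  -- the Galois sums of `w`: `τ_b • w_{N,j} = Σ_k d_{N,j,k} e_N(σ_b u_{N,k})`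
  have hgal : ∀ (N : ℕ) (j : Fin π.nb) (b : (ZMod (2 ^ N))ˣ),
      F.τ N (b : ZMod (2 ^ N)) • w N j = ∑ k, algebraMap ℚ_[2] (PadicAlgCl 2) (d N j k) * e N (sigma (2 ^ N) b (u N k)) := by
    intro N j b
    rw [hw, Finset.smul_sum]
    refine Finset.sum_congr rfl fun k _ ↦ ?_
    rw [ThetaTransport.ChildA.gal_smul_algebraMap_mul, hframe]
  refine ⟨c', w, q, ?_, one_ne_zero, ?_, ?_, ?_, ?_⟩
  · -- `q ≠ 0`
    rw [hq]
    refine mul_ne_zero ?_ ((map_ne_zero ι).mpr hr)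
    exact (map_ne_zero (algebraMap ℚ_[2] (PadicAlgCl 2))).mpr (inv_ne_zero (pow_ne_zero _ h2))
  · -- `CoordNondeg c′` from (ND)
    exact ThetaTransport.ChildA.injective_t₀Coords_of_injective π.t₀ ℓ hND s c' hc'
  · -- (BKρ) from (BK)
    intro a m i Q₀ hQv hker
    haveI := isIntegral_genFib_baseChange 2 ((WeierstrassCurve.integralModelInt W).map (Int.castRingHom ℤ_[2]))
    have hker' := (toLoc_symm_mem_kernel_iff (W := W)
      ((genFibΩ_eq_baseChange ((WeierstrassCurve.integralModelInt W).map (Int.castRingHom ℤ_[2]))).trans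
        (baseChange_twoAdicModel W)) Q₀).mp hker
    rw [hBK a m i Q₀ hQv hker', KatoBK.ptLogΩ_toLoc_symm_eq]
    simp only [hw]
    simp_rw [ThetaTransport.ChildA.sum_smul_mul_sum_algebraMap_mul, keyBK (m + 2) a i, map_sum, map_mul, Finset.sum_mul]
    rw [Finset.sum_comm]
    refine Finset.sum_congr rfl fun j _ ↦ ?_
    rw [Finset.mul_sum]
    refine Finset.sum_congr rfl fun k _ ↦ ?_
    ring
  · -- (VALρ) from (VAL) in the realisation `(ℚ̄₂, ι, e_N)`
    intro m ψ hψ1 hψ2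
    have hv := hVAL (m + 2) (by omega) (PadicAlgCl 2) ι (e (m + 2) : CyclotomicField (2 ^ (m + 2)) ℚ →+* PadicAlgCl 2)
      ψ hψ1 hψ2
    have htsum : (∑' k, algebraMap (PadicAlgCl 2) ℂ_[2]
        ((PowerSeries.coeff k (1 : IwasawaAlgebraO (Set.range ι)) : ↥(padicCoeffIntegers (Set.range ι))) : PadicAlgCl 2) *
          (algebraMap (PadicAlgCl 2) ℂ_[2] (ψ (5 : ZMod (2 ^ (m + 2)))) - 1) ^ k) = 1 := by
      rw [tsum_eq_single 0]
      · simp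
      · intro k hk
        simp [PowerSeries.coeff_one, hk]
    have hX : ∑ j, (π.bO j : PadicAlgCl 2) *
        ∑ b : (ZMod (2 ^ (m + 2)))ˣ, ψ⁻¹ (b : ZMod (2 ^ (m + 2))) * F.τ (m + 2) (b : ZMod (2 ^ (m + 2))) • w (m + 2) j =
        algebraMap ℚ_[2] (PadicAlgCl 2) (((2 : ℚ_[2]) ^ s)⁻¹) *
          ∑ k, ι (f (m + 2) k) * ∑ b : (ZMod (2 ^ (m + 2)))ˣ, ψ⁻¹ (b : ZMod (2 ^ (m + 2))) * e (m + 2) (sigma (2 ^ (m + 2)) b (u (m + 2) k)) := by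
      have hj : ∀ j, ∑ b : (ZMod (2 ^ (m + 2)))ˣ, ψ⁻¹ (b : ZMod (2 ^ (m + 2))) * F.τ (m + 2) (b : ZMod (2 ^ (m + 2))) • w (m + 2) j =
          ∑ k, algebraMap ℚ_[2] (PadicAlgCl 2) (d (m + 2) j k) *
            ∑ b : (ZMod (2 ^ (m + 2)))ˣ, ψ⁻¹ (b : ZMod (2 ^ (m + 2))) * e (m + 2) (sigma (2 ^ (m + 2)) b (u (m + 2) k)) := by
        intro j
        simp_rw [hgal, Finset.mul_sum]
        rw [Finset.sum_comm]
        refine Finset.sum_congr rfl fun k _ ↦ Finset.sum_congr rfl fun b _ ↦ ?_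
        ring
      simp_rw [hj]
      exact key (m + 2) _
    have hgauss : gaussSum ψ (AddChar.zmodChar (2 ^ (m + 2)) (HondaLog.zeta_pow_prime_pow_self (p := 2) (m + 2))) =
        gaussSum ψ (AddChar.zmodChar (2 ^ (m + 2))
          (((IsCyclotomicExtension.zeta_spec (2 ^ (m + 2)) ℚ (CyclotomicField (2 ^ (m + 2)) ℚ)).map_of_injective
            (e (m + 2) : CyclotomicField (2 ^ (m + 2)) ℚ →+* PadicAlgCl 2).injective).pow_eq_one)) := by
      have hzc : ∀ {ζ₁ ζ₂ : PadicAlgCl 2} (h₁ : ζ₁ ^ (2 ^ (m + 2)) = 1) (h₂ : ζ₂ ^ (2 ^ (m + 2)) = 1), ζ₁ = ζ₂ →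
          AddChar.zmodChar (2 ^ (m + 2)) h₁ = AddChar.zmodChar (2 ^ (m + 2)) h₂ := by
        intro ζ₁ ζ₂ h₁ h₂ h; subst h; rfl
      congr 1
      exact hzc _ _ (by rw [← he (m + 2)]; rfl)
    have hv' : (∑ k, ι (f (m + 2) k) *
          ∑ b : (ZMod (2 ^ (m + 2)))ˣ, ψ⁻¹ (b : ZMod (2 ^ (m + 2))) * e (m + 2) (sigma (2 ^ (m + 2)) b (u (m + 2) k))) *
        gaussSum ψ (AddChar.zmodChar (2 ^ (m + 2)) (HondaLog.zeta_pow_prime_pow_self (p := 2) (m + 2))) =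
        ι r * ∑ a : ZMod (2 ^ (m + 2)), ψ a * ι (plusSymbolK g Ω ((a.val : ℚ) / (2 : ℚ) ^ (m + 2))) := by
      rw [hgauss]; exact hv
    rw [hX, mul_assoc, hv', htsum, mul_one, ← map_mul, hq, mul_assoc]
  · -- (TRIVρ) from (TRIV) at `N = 2, 3` with `a₂(g) = 0`, `M` odd
    intro k hk2 hk3
    have ht := hTRIV k hk2 (PadicAlgCl 2) ι (e k : CyclotomicField (2 ^ k) ℚ →+* PadicAlgCl 2)
    have ha2' : (⟨cuspCoeff g 2, coeff_mem_coeffField g 2⟩ : coeffField g) = 0 := Subtype.ext ha2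
    have hodd : ¬ 2 ∣ M := hM.not_two_dvd_nat
    rw [ha2', map_zero, if_neg hodd] at ht
    have hX : ∑ j, (π.bO j : PadicAlgCl 2) * ∑ b : (ZMod (2 ^ k))ˣ, F.τ k (b : ZMod (2 ^ k)) • w k j =
        algebraMap ℚ_[2] (PadicAlgCl 2) (((2 : ℚ_[2]) ^ s)⁻¹) *
          ∑ k', ι (f k k') * ∑ b : (ZMod (2 ^ k))ˣ, e k (sigma (2 ^ k) b (u k k')) := by
      have hj : ∀ j, ∑ b : (ZMod (2 ^ k))ˣ, F.τ k (b : ZMod (2 ^ k)) • w k j =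
          ∑ k', algebraMap ℚ_[2] (PadicAlgCl 2) (d k j k') * ∑ b : (ZMod (2 ^ k))ˣ, e k (sigma (2 ^ k) b (u k k')) := by
        intro j
        simp_rw [hgal, Finset.mul_sum]
        rw [Finset.sum_comm]
      simp_rw [hj]
      exact key k _
    have hS : ∑ k', ι (f k k') * ∑ b : (ZMod (2 ^ k))ˣ, e k (sigma (2 ^ k) b (u k k')) =
        (3 / 2 : PadicAlgCl 2) * (ι r * ι (plusSymbolK g Ω 0)) := by
      have h2A : (2 : PadicAlgCl 2) ≠ 0 := two_ne_zero
      apply mul_left_cancel₀ h2A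
      have ht' : 2 * ∑ k', ι (f k k') * ∑ b : (ZMod (2 ^ k))ˣ, e k (sigma (2 ^ k) b (u k k')) =
          ι r * (2 - 0 + 1) * ι (plusSymbolK g Ω 0) := ht
      rw [ht']
      field_simp
      ring
    rw [hX, hS, hq]
    simp only [PowerSeries.coeff_zero_eq_constantCoeff, map_one, OneMemClass.coe_one, mul_one]
    ring

set_option maxHeartbeats 1600000 in
/-- **Litmus test: the core's hypotheses ARE the named fact's conclusion at the pins.** Kato 2004 Thm. 12.5 (1) BY NAME
(`Kato2004.exists_zetaElement_newform_tatePairing_values_two`) ⟹ `∃ z c′ w q, π.KatoValuedClass g ι Ω F.Φ F.τ z c′ w q 1` by destructuring the fact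
at the pins and the (inlined) frame of A2's `ChildA.exists_cyclotomicFrame` and handing its data to `katoValuedClass_of_zetaData` unchanged (so the merged port of
«Kato125AB», whose telescope and first five clauses are p726418's verbatim, is the same three lines plus the child-B adapter).
[cite: Kato2004Asterisque, Thm. 12.5 (1) (pp. 221–222), §15.16 (p. 265)] -/
theorem exists_katoValuedClass_one_of_zetaElement (hfact : Kato2004.exists_zetaElement_newform_tatePairing_values_two)
    (hg : IsNewform0 g) (hΩ : IsPlusPeriod g Ω) (hM : Odd M) (ha2 : cuspCoeff g 2 = 0)
    (hρ : ∀ v : HeightOneSpectrum (𝓞 ℚ), ¬ natGenerator v ∣ 2 * M →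
      ρ.IsUnramifiedAt v ∧
        ∃ P : Polynomial ↥(padicCoeffIntegers (Set.range ι)),
          P.map (padicCoeffIntegers (Set.range ι)).subtype =
              Polynomial.X ^ 2 - Polynomial.C (embCoeff g ι (natGenerator v)) * Polynomial.X +
                Polynomial.C ((natGenerator v : ℕ) : PadicAlgCl 2) ∧
            ρ.HasFrobCharpolyAt v P)
    (hκ : κ.IsCyclotomic) (hγ : κ.IsTopGenerator γ) :
    ∃ (z : I.H) (c' : Fin n → ↥(padicCoeffIntegers (Set.range ι))) (w : ℕ → Fin π.nb → PadicAlgCl 2) (q : PadicAlgCl 2),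
      π.KatoValuedClass g ι Ω F.Φ F.τ z c' w q 1 := by
  -- (P3) the cyclotomic frame of the fact from `F` (A2's `ChildA.exists_cyclotomicFrame`, inlined to stay outside the Theses cone)
  have key : ∀ k : ℕ, ∃ e : CyclotomicField (2 ^ k) ℚ →ₐ[ℚ] PadicAlgCl 2,
      e (IsCyclotomicExtension.zeta (2 ^ k) ℚ (CyclotomicField (2 ^ k) ℚ)) = zeta 2 k := by
    intro k
    obtain ⟨e, he⟩ := KatoValue.exists_ringHom_zeta_eq_padicZeta 2 k (m := 2 ^ k) rfl
    exact ⟨e.toRatAlgHom, he⟩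
  choose e he using key
  have hcoh : ∀ k, e (k + 1) (IsCyclotomicExtension.zeta (2 ^ (k + 1)) ℚ (CyclotomicField (2 ^ (k + 1)) ℚ)) ^ 2 =
      e k (IsCyclotomicExtension.zeta (2 ^ k) ℚ (CyclotomicField (2 ^ k) ℚ)) := fun k ↦ by
    rw [he, he]; exact zeta_succ_pow 2 k
  have heτ : ∀ (k : ℕ) (a : ZMod (2 ^ k)), IsUnit a →
      F.τ k a • e k (IsCyclotomicExtension.zeta (2 ^ k) ℚ (CyclotomicField (2 ^ k) ℚ)) =
        e k (IsCyclotomicExtension.zeta (2 ^ k) ℚ (CyclotomicField (2 ^ k) ℚ)) ^ a.val := fun k a ha ↦ by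
    rw [he]; exact F.hτ k a ha
  -- instantiate Kato Thm. 12.5 (1) at the pins
  obtain ⟨z, ℓ, L, f, u, r, hr, hND, hBK, hVAL, hTRIV⟩ :=
    hfact M g ι Ω ρ κ γ hg hΩ hρ hκ hγ I W n π.v π.hv (Θ π.v π.hv) (hΘ π.v π.hv) π.t₀ π.ht₀ π.nb π.bO π.bO' π.hbO π.ζ π.hζ π.ePk
      π.hμPk π.hadd₁Pk π.hadd₂Pk π.hgalPk π.hePk π.pair π.hpair F.Φ F.φ F.hΦφ
      (fun k ↦ IsCyclotomicExtension.zeta (2 ^ k) ℚ (CyclotomicField (2 ^ k) ℚ))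
      (fun k ↦ IsCyclotomicExtension.zeta_spec (2 ^ k) ℚ (CyclotomicField (2 ^ k) ℚ)) e F.τ hcoh heτ
  obtain ⟨c', w, q, hK⟩ := katoValuedClass_of_zetaData g ι Ω π F hM ha2 e he z ℓ L f u r hr hND hBK hVAL hTRIV
  exact ⟨z, c', w, q, hK⟩

end Core

end Summit.BirchSwinnertonDyer.BirchSwinnertonDyer.Theorems.OnePair

end
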